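import Summits.CriticalPhenomena.CardyFormulaZ2.Theses.CardyBondTriangular
import Summits.CriticalPhenomena.CardyFormulaZ2.Theorems.CardyIKTransportCornerLineDescentCrudeContinuity
import Literature.Probability.Percolation.QuadCrossingContinuityEventsDischarge
import HarnessLib

/-!
# Boundary insensitivity of the crude bond-`ℤ²` crossing event (stub `stub_boundaryInsensitivitySq`)

Route `CardyBondTriangular`, sub-problem `CriticalPhenomena/CardyFormulaZ2`, crux item
stmt-CriticalPhenomena-4665 (`CardyBondTriangular.TriangularToSquareTransport`), line `registered`
(skeleton `Lines/birth.lean`), stub `stub_boundaryInsensitivitySq`.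

THE STATEMENT.  For bond percolation on `ℤ²` at `p = 1/2` drawn by `squareLatticeEmbedding.z`
(`x ↦ √2 · x`) at mesh `δ`, and a conformal rectangle `R` (Jordan domain `Ω = R.carrier`, arcs
`A = R.arc 0`, `B = R.arc 2`): for every `ε > 0` there is `ρ₀ > 0` such that, eventually as `δ → 0⁺`,
for all `ρ ∈ (0, ρ₀]`, the `ρ`-RELAXED crude event (an open path with vertices in the `ρ`-thickening
of `Ω`, from a vertex within `2δ + ρ` of `A` to a vertex within `2δ + ρ` of `B`) exceeds the crude event
`embDomainCrossing` (vertices in `Ω`, endpoints within `2δ` of the arcs) in `P_{1/2}`-probability by at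
most `ε` — for EVERY conformal rectangle (no regularity of `∂Ω` is needed).

THE PROOF.  The tree already carries, for every conformal rectangle `R`, the mesh-uniform continuity of
crude bond-`ℤ²` crossing probabilities `Freeze.CrudeCrossingContinuity R`
(`CornerLineDescent.SymmetricSeed.stub_CrudeCrossingContinuity_of_SS`, file
`CardyIKTransportCornerLineDescentCrudeContinuity.lean`: for every `ε > 0` there are `κ, ρ > 0` with
`P[upperCrossing R ρ δ] ≤ P[lowerCrossing R κ ρ δ] + ε` for all small `δ`), conditionally on
Schramm–Smirnov's Lemma 5.1 for bond-`ℤ²`, which is DISCHARGED in the tree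
(`QuadCrossing.SchrammSmirnov2011_lemma_5_1_holds`, all quads, via homeomorphic charts).  The relaxed
event at radius `ρ' ≤ ρ/2` and mesh `4δ ≤ ρ` is contained in the fattened event `upperCrossing R ρ δ`
(window within `ρ` of `Ω`, endpoints within `ρ` of the arcs: `relaxed_subset_upperCrossing`), and the
thinned collar-to-collar event `lowerCrossing R κ ρ δ` is a.s. contained in the crude event
(`Freeze.lowerCrossing_subset_embDomainCrossing`, configurations on lattice edges, `√2 δ ≤ κ`).  Hence
`P[relaxed_{ρ'}] ≤ P[upper_ρ] ≤ P[lower] + ε ≤ P[crude] + ε`.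

LAYOUT.  `boundaryInsensitivitySq` is the expanded statement; the registered stub lands under its
registered header `stub_boundaryInsensitivitySq : Sig.stub_boundaryInsensitivitySq`, with a `private`
verbatim copy of the skeleton's `Sig.stub_boundaryInsensitivitySq` (same pattern as
`CardyWickAnisotropyAnisotropicBoxCardyStubAngleMap.lean`), so the skeleton's stub closes by `exact`.

References: O. Schramm, S. Smirnov, *On the scaling limits of planar percolation*, Ann. Probab. 39
(2011) 1768–1814, Lemma 5.1 and eq. (5.1), Lemma 6.1 [SchrammSmirnov2011].
-/

noncomputable section

namespace Summit.CriticalPhenomena.CardyFormulaZ2.Theorems.TriangularToSquareTransport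

open MeasureTheory Filter Set Topology
open Literature.Probability.RandomPlanarGeometry Literature.Probability.Percolation
open Literature.Probability.LatticeModels
open Summit.CriticalPhenomena.CardyFormulaZ2.Theorems.CornerLineDescent.SymmetricSeed

/-- THE RELAXED EVENT IS BELOW THE FATTENED EVENT.  If `ρ' ≤ ρ` and `2δ + ρ' ≤ ρ`, an open path with
vertices in the open `ρ'`-thickening of `Ω` from within `2δ + ρ'` of `arc 0` to within `2δ + ρ'` of
`arc 2` is an open path with vertices within `ρ` of `Ω` from within `ρ` of `arc 0` to within `ρ` of
`arc 2` (`Freeze.upperCrossing R ρ δ`): monotonicity of `openCrossing` in the window and the targets.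
[folklore] -/
theorem relaxed_subset_upperCrossing (R : ConformalRectangle) {ρ' ρ δ : ℝ} (hρ' : ρ' ≤ ρ)
    (h2 : 2 * δ + ρ' ≤ ρ) :
    openCrossing {y : Site 2 | (δ : ℂ) * squareLatticeEmbedding.z y ∈ Metric.thickening ρ' R.carrier}
        {u : Site 2 | Metric.infDist ((δ : ℂ) * squareLatticeEmbedding.z u) (R.arc 0) ≤ 2 * δ + ρ'}
        {v : Site 2 | Metric.infDist ((δ : ℂ) * squareLatticeEmbedding.z v) (R.arc 2) ≤ 2 * δ + ρ'} ⊆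
      Freeze.upperCrossing R ρ δ := by
  refine Literature.Probability.Percolation.openCrossing_mono ?_ ?_ ?_
  · intro y hy
    simp only [mem_setOf_eq] at hy ⊢
    obtain ⟨a, ha, hya⟩ := Metric.mem_thickening_iff.1 hy
    exact ((Metric.infDist_le_dist_of_mem ha).trans hya.le).trans hρ'
  · intro u hu
    simp only [mem_setOf_eq] at hu ⊢
    exact hu.trans h2
  · intro v hv
    simp only [mem_setOf_eq] at hv ⊢
    exact hv.trans h2

/-- **Boundary insensitivity of the crude event on bond-`ℤ²` at `p = 1/2`, for EVERY conformal
rectangle** (expanded form of the stub `stub_boundaryInsensitivitySq` below).  For every conformal rectangle `R` and `ε > 0` there is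
`ρ₀ > 0` such that, eventually as `δ → 0⁺`, for all `ρ ∈ (0, ρ₀]`, the `ρ`-relaxed crude crossing
event (vertices in `Metric.thickening ρ R.carrier`, endpoints within `2δ + ρ` of `R.arc 0` / `R.arc 2`)
has `P_{1/2}`-probability at most that of the crude event
`embDomainCrossing squareLatticeEmbedding.z R.carrier δ (R.arc 0) (R.arc 2)` plus `ε`.
Proof: the tree's mesh-uniform crude-crossing continuity for bond-`ℤ²`
(`stub_CrudeCrossingContinuity_of_SS` at the discharged `SchrammSmirnov2011_lemma_5_1_holds`) gives
`κ, ρ > 0` with `P[upper_ρ] ≤ P[lower_{κ,ρ}] + ε` eventually; take `ρ₀ = ρ/2` and meshes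
`δ < min (κ/2) (ρ/4)`; then `relaxed_{ρ'} ⊆ upper_ρ` (`relaxed_subset_upperCrossing`) and
`lower_{κ,ρ} ⊆ crude` a.s. (`Freeze.lowerCrossing_subset_embDomainCrossing`).
[cite: SchrammSmirnov2011, Lemma 5.1] -/
theorem boundaryInsensitivitySq :
    ∀ R : Literature.Probability.RandomPlanarGeometry.ConformalRectangle, ∀ ε : ℝ, 0 < ε → ∃ ρ₀ : ℝ, 0 < ρ₀ ∧
      ∀ᶠ δ : ℝ in 𝓝[>] (0 : ℝ), ∀ ρ ∈ Set.Ioc (0 : ℝ) ρ₀,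
        (Literature.Probability.Percolation.bondPercolation (Literature.Probability.LatticeModels.zdGraph 2) Literature.Probability.Percolation.half).real (Literature.Probability.Percolation.openCrossing {y : Literature.Probability.LatticeModels.Site 2 | (δ : ℂ) * Literature.Probability.LatticeModels.squareLatticeEmbedding.z y ∈ Metric.thickening ρ R.carrier} {u : Literature.Probability.LatticeModels.Site 2 | Metric.infDist ((δ : ℂ) * Literature.Probability.LatticeModels.squareLatticeEmbedding.z u) (R.arc 0) ≤ 2 * δ + ρ} {v : Literature.Probability.LatticeModels.Site 2 | Metric.infDist ((δ : ℂ) * Literature.Probability.LatticeModels.squareLatticeEmbedding.z v) (R.arc 2) ≤ 2 * δ + ρ})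
          ≤ (Literature.Probability.Percolation.bondPercolation (Literature.Probability.LatticeModels.zdGraph 2) Literature.Probability.Percolation.half).real (Literature.Probability.Percolation.embDomainCrossing Literature.Probability.LatticeModels.squareLatticeEmbedding.z R.carrier δ (R.arc 0) (R.arc 2)) + ε := by
  intro R ε hε
  obtain ⟨κ, hκ, ρ, hρ, hev⟩ :=
    stub_CrudeCrossingContinuity_of_SS QuadCrossing.SchrammSmirnov2011_lemma_5_1_holds R ε hε
  refine ⟨ρ / 2, half_pos hρ, ?_⟩
  have hδ₀ : (0 : ℝ) < min (κ / 2) (ρ / 4) := lt_min (half_pos hκ) (by positivity)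
  filter_upwards [hev, Ioo_mem_nhdsGT hδ₀] with δ hC hδI ρ' hρ'
  have hδ : 0 < δ := hδI.1
  have hδκ : 2 * δ ≤ κ := by
    have h := lt_of_lt_of_le hδI.2 (min_le_left _ _)
    linarith
  have hδρ : 4 * δ ≤ ρ := by
    have h := lt_of_lt_of_le hδI.2 (min_le_right _ _)
    linarith
  obtain ⟨-, hρ'le⟩ := hρ'
  have hsq : Real.sqrt 2 * δ ≤ κ := by
    have h2 : Real.sqrt 2 ≤ 2 := (Real.sqrt_le_left zero_le_two).2 (by norm_num)
    nlinarith
  -- the relaxed event is below the fattened event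
  have hRU : (bondPercolation (zdGraph 2) half).real
      (openCrossing {y : Site 2 | (δ : ℂ) * squareLatticeEmbedding.z y ∈ Metric.thickening ρ' R.carrier}
        {u : Site 2 | Metric.infDist ((δ : ℂ) * squareLatticeEmbedding.z u) (R.arc 0) ≤ 2 * δ + ρ'}
        {v : Site 2 | Metric.infDist ((δ : ℂ) * squareLatticeEmbedding.z v) (R.arc 2) ≤ 2 * δ + ρ'}) ≤
      (bondPercolation (zdGraph 2) half).real (Freeze.upperCrossing R ρ δ) :=
    measureReal_mono (relaxed_subset_upperCrossing R (by linarith) (by linarith))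
  -- the thinned event is below the crude event (a.s.: configurations on lattice edges)
  have hae : ∀ᵐ η ∂ bondPercolation (zdGraph 2) half, η ⊆ (zdGraph 2).edgeSet := ae_subset_edgeSet _ _
  have hLcr : (bondPercolation (zdGraph 2) half).real (Freeze.lowerCrossing R κ ρ δ) ≤
      (bondPercolation (zdGraph 2) half).real
        (embDomainCrossing squareLatticeEmbedding.z R.carrier δ (R.arc 0) (R.arc 2)) := by
    refine ENNReal.toReal_mono (measure_ne_top _ _) (measure_mono_ae ?_)
    filter_upwards [hae] with η hη hL
    exact Freeze.lowerCrossing_subset_embDomainCrossing R hδ hρ.le hsq hη hL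
  linarith

/-! ### The registered stub, under its registered header -/

/-- Signature of `stub_boundaryInsensitivitySq`, verbatim the body of `Sig.stub_boundaryInsensitivitySq`
of the registered skeleton of crux `TriangularToSquareTransport` (line `registered`,
`Cruxes/TriangularToSquareTransport/Lines/birth.lean`), so that the stub lands under the registered
header `stub_boundaryInsensitivitySq : Sig.stub_boundaryInsensitivitySq` and closes the skeleton's stub
by `exact` (the two `Sig` definitions are syntactically, hence definitionally, equal).  Kept `private`
so that sibling stub files may carry their own copy without a name clash on import; use
`boundaryInsensitivitySq` for the expanded statement.  A statement only: it is the type of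
`stub_boundaryInsensitivitySq` below and is asserted nowhere else. -/
private def Sig.stub_boundaryInsensitivitySq : Prop :=
    ∀ R : Literature.Probability.RandomPlanarGeometry.ConformalRectangle, ∀ ε : ℝ, 0 < ε → ∃ ρ₀ : ℝ, 0 < ρ₀ ∧
      ∀ᶠ δ : ℝ in 𝓝[>] (0 : ℝ), ∀ ρ ∈ Set.Ioc (0 : ℝ) ρ₀,
        (Literature.Probability.Percolation.bondPercolation (Literature.Probability.LatticeModels.zdGraph 2) Literature.Probability.Percolation.half).real (Literature.Probability.Percolation.openCrossing {y : Literature.Probability.LatticeModels.Site 2 | (δ : ℂ) * Literature.Probability.LatticeModels.squareLatticeEmbedding.z y ∈ Metric.thickening ρ R.carrier} {u : Literature.Probability.LatticeModels.Site 2 | Metric.infDist ((δ : ℂ) * Literature.Probability.LatticeModels.squareLatticeEmbedding.z u) (R.arc 0) ≤ 2 * δ + ρ} {v : Literature.Probability.LatticeModels.Site 2 | Metric.infDist ((δ : ℂ) * Literature.Probability.LatticeModels.squareLatticeEmbedding.z v) (R.arc 2) ≤ 2 * δ + ρ})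
          ≤ (Literature.Probability.Percolation.bondPercolation (Literature.Probability.LatticeModels.zdGraph 2) Literature.Probability.Percolation.half).real (Literature.Probability.Percolation.embDomainCrossing Literature.Probability.LatticeModels.squareLatticeEmbedding.z R.carrier δ (R.arc 0) (R.arc 2)) + ε

/-- **Stub `stub_boundaryInsensitivitySq`** (line `registered` of crux `TriangularToSquareTransport`,
stmt-CriticalPhenomena-4665): boundary insensitivity of the crude bond-`ℤ²` crossing event at
`p = 1/2` — for every conformal rectangle `R` and `ε > 0` there is `ρ₀ > 0` with
`P[relaxed_ρ(R, δ)] ≤ P[crude(R, δ)] + ε` for all `ρ ∈ (0, ρ₀]`, eventually as `δ → 0⁺`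
(see `boundaryInsensitivitySq`; from the tree's PROVED crude-crossing continuity for bond-`ℤ²`,
`stub_CrudeCrossingContinuity_of_SS` ∘ `SchrammSmirnov2011_lemma_5_1_holds`).
[cite: SchrammSmirnov2011, Lemma 5.1] -/
theorem stub_boundaryInsensitivitySq : Sig.stub_boundaryInsensitivitySq :=
  boundaryInsensitivitySq

end Summit.CriticalPhenomena.CardyFormulaZ2.Theorems.TriangularToSquareTransport

end
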